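import Mathlib.Algebra.Torsor.Basic
import Literature.IUT.HodgeTheaters.PMBaseModels

/-!
# [IUTchI] Def 6.1 (i)/(iii)/(v): the `𝔽_l^±`-group / `𝔽_l^±`-torsor structure CONSTRUCTED from a cusp torsor

S. Mochizuki, *Inter-universal Teichmüller theory I*, kurims manuscript (May 2020), §6 Definition 6.1 (i)
p. 155 ("an `𝔽_l^±`-group is a set `E` equipped with a `{±1}`-orbit of bijections `E ⥲ 𝔽_l`"; "an
`𝔽_l^±`-torsor is a set `T` equipped with an `𝔽_l^{⋊±}`-orbit of bijections `T ⥲ 𝔽_l`"), (iii) p. 157 ("we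
obtain a natural bijection `LabCusp^±(†𝒟_v) ⥲ 𝔽_l` — which is well-defined up to multiplication by `±1` … an
`𝔽_l^±`-group structure"), (v) p. 158 ("`Aut_±(𝒟^{⊚±})` … acts transitively on the cusps of `X_K`", "the cusp `ε`
determines … a natural `𝔽_l^±`-torsor structure on the set `LabCusp^±(𝒟^{⊚±})`")
([IUTchI] Def 6.1 (i) p.155) [claim: Mochizuki2012, status: disputed] (D-0012 claim key, series status
DISPUTED — this file is label COMBINATORICS over `ZMod l`; nothing of the series is asserted, no side is taken
on [IUTchIII] Cor. 3.12).

## Why (KIT-INSTANCE-SPEC P3; L5-lead RULINGS #17 (3) GO)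

abc-iut-L5-t4's §6 kit `PMBaseKit` takes the `𝔽_l^±`-group structures `labPM v X : FlPMGroup l (LabCuspPM v X)`
and the `𝔽_l^±`-torsor structure `gLabT : FlPMTorsor l (GLab gModel)` as DATA (`LabelsPlusMinus.lean`,
`LabelsPlusMinusTorsors.lean`).  At the genuine instance (the Π-avatar of `ℬ(X̲_v)⁰`, `ℬ(X_K)⁰`) what geometry
delivers is a set of cusps carrying a SIMPLY TRANSITIVE action of a cyclic group of order `l`
(`Gal(X̲_v/X_v) ≅ Δ_{X_v}/Δ_{X̲_v}`, resp. `Gal(X_K/X'_K)`, the rank-one quotient of `Δ^{ab} ⊗ 𝔽_l`, Def 6.1 (v))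
identified with `ℤ/l` up to SIGN, plus — for the GROUP structure — a distinguished (zero-labelled) cusp.  This
file is that constructor, read backwards from abc-iut-L6-t7's `LabCuspKitBridge` (kit ⟶ `LabCuspStructure`):

* `FlPMTorsor.ofAddTorsor l S` — from a simply transitive `ZMod l`-action (Mathlib `AddTorsor (ZMod l) S`): the
  charts are ALL sign-affine bijections `e (q +ᵥ s) = ε•q + e s` (`mem_ofAddTorsor_charts_iff`), i.e. the
  `𝔽_l^{⋊±}`-orbit of `s ↦ s -ᵥ s₀`; the characterisation is symmetric in `ε`, so the structure does NOT depend
  on the sign of the identification `Gal ≅ ℤ/l` — print's "well-defined up to `𝔽_l^{⋊±}`";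
* `FlPMGroup.ofAddTorsor l s₀` — with a base point: the `{±1}`-orbit of `s ↦ s -ᵥ s₀`, characterised as the
  sign-affine bijections vanishing at `s₀` (`mem_ofAddTorsor_charts_iff`) — "well-defined up to `±1`";
* `FlPMGroup.ofAddTorsor_toTorsor` — forgetting the base point gives the torsor structure ([IUTchI] Def 6.4
  (iii) "the `𝔽_l^±`-torsor structure determined by the `𝔽_l^±`-group structure", abc-iut-L5-t4 `toTorsor`);
* TRANSPORT along sign-equivariant bijections (`trans_mem_charts_of_semiEquivariant`, both flavours) — the shape
  of the kit fields `labMap_charts` / `labOfHom_phiEll_charts` / `gLab_range`;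
* the POINT REFLECTION through `s₀` (Mathlib `Equiv.pointReflection`; `pointReflection_semiEquivariant`, `pointReflection_ne_refl` for `2 < l`)
  — the supplier of the kit field `exists_negative` (Def 6.1 (iii) "natural surjection `Aut(†𝒟_v) ↠ {±1}`");
* sign-affine self-maps lie in `Aut_±(T)` (`mem_autPM_of_semiEquivariant`, Def 6.1 (v)).

Pure combinatorics over Mathlib's `AddTorsor`; no instance is declared, no notation, no `Prop` fact; every
`theorem` is kernel-checked.  typed ≠ proved elsewhere.
-/

namespace Literature.IUT.HodgeTheaters

variable (l : ℕ)

/-! ### Sign-affine maps between `ZMod l`-torsors -/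

section SemiEquivariant

variable {l} {S S' : Type*} [AddTorsor (ZMod l) S] [AddTorsor (ZMod l) S']

/-- A bijection of cusp sets is **sign-equivariant** with sign `ε ∈ {±1}` if it intertwines the cyclic actions
up to `ε`: `f (q +ᵥ s) = (ε•q) +ᵥ f s` ([IUTchI] Def 6.1 (i) p.155: the automorphisms "`z ↦ ±z + λ`"; geometrically
`ε = −1` for maps through the inversion of the elliptic curve, Def 6.1 (iii)/(v), Rmk 6.1.1).
([IUTchI] Def 6.1 (i) p.155) [claim: Mochizuki2012, status: disputed] -/
def IsSemiEquivariant (ε : ℤˣ) (f : S ≃ S') : Prop := ∀ (q : ZMod l) (s : S), f (q +ᵥ s) = (ε • q) +ᵥ f s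

/-- The identity is sign-equivariant with sign `+1`. ([IUTchI] Def 6.1 (i) p.155) [claim: Mochizuki2012, status: disputed] -/
theorem isSemiEquivariant_refl : IsSemiEquivariant (l := l) 1 (Equiv.refl S) := fun q s => by simp

/-- Signs multiply under composition. ([IUTchI] Def 6.1 (i) p.155) [claim: Mochizuki2012, status: disputed] -/
theorem IsSemiEquivariant.trans {S'' : Type*} [AddTorsor (ZMod l) S''] {ε η : ℤˣ} {f : S ≃ S'} {g : S' ≃ S''}
    (hf : IsSemiEquivariant (l := l) ε f) (hg : IsSemiEquivariant (l := l) η g) :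
    IsSemiEquivariant (l := l) (η * ε) (f.trans g) := fun q s => by
  simp only [Equiv.trans_apply]
  rw [hf, hg, smul_smul]

/-- The inverse of a sign-equivariant bijection is sign-equivariant with the same sign (`ε² = 1`).
([IUTchI] Def 6.1 (i) p.155) [claim: Mochizuki2012, status: disputed] -/
theorem IsSemiEquivariant.symm {ε : ℤˣ} {f : S ≃ S'} (hf : IsSemiEquivariant (l := l) ε f) :
    IsSemiEquivariant (l := l) ε f.symm := fun q s' => by
  apply f.injective
  rw [Equiv.apply_symm_apply, hf, Equiv.apply_symm_apply, smul_smul, Int.units_mul_self, one_smul]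

end SemiEquivariant

/-! ### The `𝔽_l^±`-torsor structure of a cusp torsor (Def 6.1 (i), (v)) -/

namespace FlPMTorsor

variable {l} (S : Type*) [AddTorsor (ZMod l) S]

variable (l) in
/-- **The `𝔽_l^±`-TORSOR structure of a simply transitive `ℤ/l`-set** ([IUTchI] Def 6.1 (i) p. 155: "an
`𝔽_l^{⋊±}`-orbit of bijections `T ⥲ 𝔽_l`"; (v) p. 158 for `LabCusp^±(𝒟^{⊚±})` = the cusps of `X_K`): the charts are
the bijections `s ↦ g • (s -ᵥ s₀)` for all base points `s₀ ∈ S` and `g ∈ 𝔽_l^{⋊±}` — equivalently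
(`mem_ofAddTorsor_charts_iff`) ALL sign-affine bijections `S ⥲ 𝔽_l`.
([IUTchI] Def 6.1 (i) p.155) [claim: Mochizuki2012, status: disputed] -/
def ofAddTorsor [Nonempty S] : FlPMTorsor l S where
  charts := {e | ∃ ε : ℤˣ, ∀ (q : ZMod l) (s : S), e (q +ᵥ s) = ε • q + e s}
  nonempty := by
    obtain ⟨s₀⟩ := ‹Nonempty S›
    refine ⟨(Equiv.vaddConst s₀).symm, 1, fun q s => ?_⟩
    simp [vadd_vsub_assoc]
  eq_orbit := by
    rintro e ⟨ε, he⟩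
    ext e'
    constructor
    · rintro ⟨ε', he'⟩
      -- `e' ∘ e⁻¹` is a sign-affine bijection of `𝔽_l`, i.e. an element of `𝔽_l^{⋊±}`
      have key : ∀ s, e' s = (ε' * ε) • e s + e' (e.symm 0) := by
        intro s
        have hs : s = (ε • e s) +ᵥ e.symm 0 := by
          apply e.injective
          rw [he, smul_smul, Int.units_mul_self, one_smul, Equiv.apply_symm_apply, add_zero]
        calc e' s = e' ((ε • e s) +ᵥ e.symm 0) := by rw [← hs]
          _ = ε' • (ε • e s) + e' (e.symm 0) := he' _ _
          _ = (ε' * ε) • e s + e' (e.symm 0) := by rw [smul_smul]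
      refine ⟨FlPM.mk (e' (e.symm 0)) (ε' * ε), Equiv.ext fun s => ?_⟩
      rw [Equiv.trans_apply, FlPM.toPerm_apply, FlPM.mk_smul]
      exact (key s).symm
    · rintro ⟨g, rfl⟩
      refine ⟨g.right * ε, fun q s => ?_⟩
      rw [Equiv.trans_apply, Equiv.trans_apply, FlPM.toPerm_apply, FlPM.toPerm_apply, he, FlPM.smul_def,
        FlPM.smul_def, smul_add, smul_smul, add_assoc]

/-- Charts of the torsor structure of a cusp torsor = the SIGN-AFFINE bijections `S ⥲ 𝔽_l`
(`e (q +ᵥ s) = ε•q + e s` for a sign `ε`); in particular the structure is unchanged if the identification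
`Gal ≅ ℤ/l` is replaced by its negative ("well-defined up to" `𝔽_l^{⋊±}`, Def 6.1 (i)).
([IUTchI] Def 6.1 (i) p.155) [claim: Mochizuki2012, status: disputed] -/
theorem mem_ofAddTorsor_charts_iff [Nonempty S] (e : S ≃ ZMod l) :
    e ∈ (ofAddTorsor l S).charts ↔ ∃ ε : ℤˣ, ∀ (q : ZMod l) (s : S), e (q +ᵥ s) = ε • q + e s :=
  Iff.rfl

/-- The difference chart `s ↦ s -ᵥ s₀` at any base point is a chart of the torsor structure.
([IUTchI] Def 6.1 (i) p.155) [claim: Mochizuki2012, status: disputed] -/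
theorem vsub_mem_ofAddTorsor_charts [Nonempty S] (s₀ : S) :
    (Equiv.vaddConst s₀).symm ∈ (ofAddTorsor l S).charts :=
  ⟨1, fun q s => by simp [vadd_vsub_assoc]⟩

variable {S}

/-- **Transport** ([IUTchI] Def 6.1 (v) p.158 / Prop 6.5 (i) p.163 "compatible with the respective
`𝔽_l^±`-torsor structures"): pulling a chart back along a sign-equivariant bijection of cusp torsors gives a
chart — the shape of the kit laws `gLab_range` / `labOfHom_phiEll_charts`.
([IUTchI] Def 6.1 (v) p.158) [claim: Mochizuki2012, status: disputed] -/
theorem trans_mem_charts_of_semiEquivariant {S' : Type*} [AddTorsor (ZMod l) S'] [Nonempty S] [Nonempty S']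
    {ε : ℤˣ} {f : S ≃ S'} (hf : IsSemiEquivariant (l := l) ε f) {e : S' ≃ ZMod l}
    (he : e ∈ (ofAddTorsor l S').charts) : f.trans e ∈ (ofAddTorsor l S).charts := by
  obtain ⟨η, hη⟩ := he
  exact ⟨η * ε, fun q s => by rw [Equiv.trans_apply, Equiv.trans_apply, hf, hη, smul_smul]⟩

/-- Sign-affine self-bijections of a cusp torsor are elements of `Aut_±(T)` ([IUTchI] Def 6.1 (i)/(v) p.158:
"`Aut_K(X_K) ⥲ Aut_±(𝒟^{⊚±})/Aut_csp(𝒟^{⊚±}) ⥲ 𝔽_l^{⋊±}`" acting on the cusps) — the shape of the kit law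
`gLab_range`, forward direction. ([IUTchI] Def 6.1 (v) p.158) [claim: Mochizuki2012, status: disputed] -/
theorem mem_autPM_of_semiEquivariant [Nonempty S] {ε : ℤˣ} {f : S ≃ S} (hf : IsSemiEquivariant (l := l) ε f) :
    (f : Equiv.Perm S) ∈ (ofAddTorsor l S).autPM := by
  rintro e ⟨η, hη⟩
  obtain ⟨s₀⟩ := ‹Nonempty S›
  refine ⟨FlPM.mk (e (f s₀) - (η * ε * η) • e s₀) (η * ε * η), fun s => ?_⟩
  have hs : s = (η • (e s - e s₀)) +ᵥ s₀ := by
    apply e.injective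
    rw [hη, smul_smul, Int.units_mul_self, one_smul, sub_add_cancel]
  change e (f s) = FlPM.mk _ _ • e s
  rw [FlPM.mk_smul]
  calc e (f s) = e (f ((η • (e s - e s₀)) +ᵥ s₀)) := by rw [← hs]
    _ = e ((ε • η • (e s - e s₀)) +ᵥ f s₀) := by rw [hf]
    _ = η • (ε • η • (e s - e s₀)) + e (f s₀) := hη _ _
    _ = (η * ε * η) • e s + (e (f s₀) - (η * ε * η) • e s₀) := by
      rw [smul_smul, smul_smul, smul_sub]
      abel

end FlPMTorsor

/-! ### The `𝔽_l^±`-group structure of a POINTED cusp torsor (Def 6.1 (i), (iii)) -/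

namespace FlPMGroup

variable {l} {S : Type*} [AddTorsor (ZMod l) S]

variable (l) in
/-- **The `𝔽_l^±`-GROUP structure of a simply transitive `ℤ/l`-set with a distinguished point `s₀`** ([IUTchI]
Def 6.1 (i) p. 155: "a `{±1}`-orbit of bijections `E ⥲ 𝔽_l`"; (iii) p. 157: "a natural bijection
`LabCusp^±(†𝒟_v) ⥲ 𝔽_l` … well-defined up to multiplication by `±1`", the zero being the distinguished cusp):
charts `s ↦ ±(s -ᵥ s₀)`. ([IUTchI] Def 6.1 (iii) p.157) [claim: Mochizuki2012, status: disputed] -/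
def ofAddTorsor (s₀ : S) : FlPMGroup l S where
  charts := Set.range fun ε : ℤˣ => (Equiv.vaddConst s₀).symm.trans (signPerm l ε)
  nonempty := ⟨_, 1, rfl⟩
  eq_orbit := by
    rintro e ⟨ε, rfl⟩
    ext e'
    constructor
    · rintro ⟨η, rfl⟩
      refine ⟨ε * η, Equiv.ext fun s => ?_⟩
      simp [smul_smul, mul_comm ε η, mul_assoc]
    · rintro ⟨η, rfl⟩
      refine ⟨η * ε, Equiv.ext fun s => ?_⟩
      simp [smul_smul]

/-- Charts of the group structure of a pointed cusp torsor = the sign-affine bijections VANISHING at the base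
point; symmetric in the sign, hence independent of the sign of `Gal ≅ ℤ/l` ("well-defined up to `±1`").
([IUTchI] Def 6.1 (iii) p.157) [claim: Mochizuki2012, status: disputed] -/
theorem mem_ofAddTorsor_charts_iff (s₀ : S) (e : S ≃ ZMod l) :
    e ∈ (ofAddTorsor l s₀).charts ↔ e s₀ = 0 ∧ ∃ ε : ℤˣ, ∀ (q : ZMod l) (s : S), e (q +ᵥ s) = ε • q + e s := by
  constructor
  · rintro ⟨ε, rfl⟩
    refine ⟨by simp, ε, fun q s => ?_⟩
    simp [vadd_vsub_assoc, smul_add]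
  · rintro ⟨h0, ε, hε⟩
    refine ⟨ε, Equiv.ext fun s => ?_⟩
    have hs : s = (s -ᵥ s₀) +ᵥ s₀ := (vsub_vadd s s₀).symm
    conv_rhs => rw [hs, hε, h0, add_zero]
    simp

/-- The base point is the ZERO of the group structure (its label is `0` in every chart).
([IUTchI] Def 6.1 (iii) p.157) [claim: Mochizuki2012, status: disputed] -/
theorem chart_basePoint {s₀ : S} {e : S ≃ ZMod l} (he : e ∈ (ofAddTorsor l s₀).charts) : e s₀ = 0 :=
  ((mem_ofAddTorsor_charts_iff s₀ e).1 he).1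

/-- Charts of the pointed structure are charts of the unpointed torsor structure … ([IUTchI] Def 6.4 (iii) p.163)
[claim: Mochizuki2012, status: disputed] -/
theorem charts_subset_torsor [Nonempty S] (s₀ : S) :
    (ofAddTorsor l s₀).charts ⊆ (FlPMTorsor.ofAddTorsor l S).charts := fun e he =>
  ((mem_ofAddTorsor_charts_iff s₀ e).1 he).2

/-- … and **forgetting the base point IS abc-iut-L5-t4's `toTorsor`** ("the `𝔽_l^±`-torsor structure determined by
the `𝔽_l^±`-group structure", [IUTchI] Def 6.4 (iii) p. 163): the `𝔽_l^{⋊±}`-saturation of the `{±1}`-orbit of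
`s ↦ s -ᵥ s₀` is the set of all sign-affine bijections, whatever `s₀`.
([IUTchI] Def 6.4 (iii) p.163) [claim: Mochizuki2012, status: disputed] -/
theorem ofAddTorsor_toTorsor [Nonempty S] (s₀ : S) :
    (ofAddTorsor l s₀).toTorsor = FlPMTorsor.ofAddTorsor l S := by
  have key : (ofAddTorsor l s₀).toTorsor.charts = (FlPMTorsor.ofAddTorsor l S).charts := by
    rw [(ofAddTorsor l s₀).toTorsor.eq_orbit _ ((ofAddTorsor l s₀).mem_toTorsor_charts ⟨1, rfl⟩),
      (FlPMTorsor.ofAddTorsor l S).eq_orbit _ (FlPMTorsor.vsub_mem_ofAddTorsor_charts S s₀)]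
    ext e
    simp only [Set.mem_range]
    constructor <;> rintro ⟨g, rfl⟩ <;> exact ⟨g, Equiv.ext fun s => by simp⟩
  cases h : (ofAddTorsor l s₀).toTorsor
  cases h' : FlPMTorsor.ofAddTorsor l S
  simp only [h, h'] at key
  subst key
  rfl

/-- **Transport along sign-equivariant bijections preserving base points** ([IUTchI] Def 6.1 (iii) p.157:
functoriality of `LabCusp^±(−)` in isomorphisms `†𝒟_v ⥲ ‡𝒟_v`; Prop 6.5 (i) "compatible with the respective
`𝔽_l^±`-group structures") — the shape of the kit law `labMap_charts`: pulled-back charts are charts.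
([IUTchI] Def 6.1 (iii) p.157) [claim: Mochizuki2012, status: disputed] -/
theorem trans_mem_charts_of_semiEquivariant {S' : Type*} [AddTorsor (ZMod l) S'] {s₀ : S} {s₀' : S'}
    {ε : ℤˣ} {f : S ≃ S'} (hf : IsSemiEquivariant (l := l) ε f) (h0 : f s₀ = s₀') {e : S' ≃ ZMod l}
    (he : e ∈ (ofAddTorsor l s₀').charts) : f.trans e ∈ (ofAddTorsor l s₀).charts := by
  rw [mem_ofAddTorsor_charts_iff] at he ⊢
  obtain ⟨he0, η, hη⟩ := he
  exact ⟨by rw [Equiv.trans_apply, h0, he0],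
    η * ε, fun q s => by rw [Equiv.trans_apply, Equiv.trans_apply, hf, hη, smul_smul]⟩

/-- Conversely a bijection carrying charts to charts preserves the base points (labels `0 ↦ 0`).
([IUTchI] Def 6.1 (iii) p.157) [claim: Mochizuki2012, status: disputed] -/
theorem apply_basePoint_of_trans_mem_charts {S' : Type*} [AddTorsor (ZMod l) S'] {s₀ : S} {s₀' : S'}
    {f : S ≃ S'} {e : S' ≃ ZMod l} (he : e ∈ (ofAddTorsor l s₀').charts)
    (hfe : f.trans e ∈ (ofAddTorsor l s₀).charts) : f s₀ = s₀' := by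
  apply e.injective
  rw [chart_basePoint he, ← Equiv.trans_apply f e s₀, chart_basePoint hfe]

/-! ### The negative automorphism: point reflection (Def 6.1 (iii) `Aut(†𝒟_v) ↠ {±1}`) -/

/-- The POINT REFLECTION of a cusp torsor through `s₀` (Mathlib `Equiv.pointReflection s₀ : s ↦ (s₀ -ᵥ s) +ᵥ s₀`;
geometrically: the automorphism of `X̲_v` / `X_K` induced by the inversion of the elliptic curve, [IUTchI]
Def 6.1 (iii), Rmk 6.1.1) is sign-equivariant with sign `−1` — a NEGATIVE automorphism.
([IUTchI] Def 6.1 (iii) p.157) [claim: Mochizuki2012, status: disputed] -/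
theorem pointReflection_semiEquivariant (s₀ : S) :
    IsSemiEquivariant (l := l) (-1) (Equiv.pointReflection s₀) := by
  intro q s
  rw [Equiv.pointReflection_apply, Equiv.pointReflection_apply, vsub_vadd_eq_vsub_sub, vadd_vadd,
    Units.neg_smul, one_smul, neg_add_eq_sub]

/-- Hence it carries charts of the pointed structure to charts (it acts on `LabCusp^±` by `−1`).
([IUTchI] Def 6.1 (iii) p.157) [claim: Mochizuki2012, status: disputed] -/
theorem pointReflection_trans_mem_charts (s₀ : S) {e : S ≃ ZMod l} (he : e ∈ (ofAddTorsor l s₀).charts) :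
    (Equiv.pointReflection s₀).trans e ∈ (ofAddTorsor l s₀).charts :=
  trans_mem_charts_of_semiEquivariant (pointReflection_semiEquivariant s₀) (Equiv.pointReflection_self s₀) he

/-- The point reflection acts on every chart by the sign `−1`: `e ∘ ρ = −e`.
([IUTchI] Def 6.1 (iii) p.157) [claim: Mochizuki2012, status: disputed] -/
theorem chart_pointReflection {s₀ : S} {e : S ≃ ZMod l} (he : e ∈ (ofAddTorsor l s₀).charts) (s : S) :
    e (Equiv.pointReflection s₀ s) = -e s := by
  obtain ⟨ε, rfl⟩ := he
  change ε • ((Equiv.pointReflection s₀ s) -ᵥ s₀) = -(ε • (s -ᵥ s₀))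
  rw [Equiv.pointReflection_vsub_left, ← neg_vsub_eq_vsub_rev s s₀, smul_neg]

/-- For `2 < l` the point reflection is NOT the identity on a nonempty cusp torsor (it moves `1 +ᵥ s₀`): the
supplier of the kit field `PMBaseKit.exists_negative` ("natural surjection `Aut(†𝒟_v) ↠ {±1}`", [IUTchI]
Def 6.1 (iii) p. 157; cf. L5-t1's `FlPMTorsor.reflection_not_mem_autPlus`).
([IUTchI] Def 6.1 (iii) p.157) [claim: Mochizuki2012, status: disputed] -/
theorem pointReflection_ne_refl (hl : 2 < l) (s₀ : S) : Equiv.pointReflection s₀ ≠ Equiv.refl S := by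
  intro h
  have h1 := congrArg (fun f : S ≃ S => (f ((1 : ZMod l) +ᵥ s₀)) -ᵥ s₀) h
  simp only [Equiv.pointReflection_vsub_left, vsub_vadd_eq_vsub_sub, vsub_self, zero_sub, vadd_vsub,
    Equiv.refl_apply] at h1
  -- `-1 = 1` in `ZMod l` forces `l ∣ 2`
  have h2 : ((2 : ℕ) : ZMod l) = 0 := by
    calc ((2 : ℕ) : ZMod l) = 1 + 1 := by norm_num
      _ = 1 + -1 := by rw [h1]
      _ = 0 := add_neg_cancel 1
  rw [ZMod.natCast_eq_zero_iff] at h2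
  exact absurd (Nat.le_of_dvd two_pos h2) (not_le.mpr hl)

end FlPMGroup

/-! ### Consistency with the model structures: `𝔽_l` as a cusp torsor over itself -/

/-- Two `𝔽_l^±`-group structures with the same orbit of charts are equal (the remaining fields are proofs).
([IUTchI] Def 6.1 (i) p.155) [claim: Mochizuki2012, status: disputed] -/
theorem FlPMGroup.eq_of_charts_eq {l : ℕ} {E : Type*} {S₁ S₂ : FlPMGroup l E} (h : S₁.charts = S₂.charts) :
    S₁ = S₂ := by
  cases S₁; cases S₂; cases h; rfl

/-- Two `𝔽_l^±`-torsor structures with the same orbit of charts are equal.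
([IUTchI] Def 6.1 (i) p.155) [claim: Mochizuki2012, status: disputed] -/
theorem FlPMTorsor.eq_of_charts_eq {l : ℕ} {T : Type*} {S₁ S₂ : FlPMTorsor l T} (h : S₁.charts = S₂.charts) :
    S₁ = S₂ := by
  cases S₁; cases S₂; cases h; rfl

/-- **KIT-RULE / consistency**: `𝔽_l` acting on itself by translation with base point `0` yields EXACTLY the
tautological `𝔽_l^±`-group structure of abc-iut-L5-t4's model bridges ([IUTchI] Ex 6.2 (i) p.159 "think of `𝔽_l`
as an `𝔽_l^±`-group [relative to the tautological `𝔽_l^±`-group structure]", `FlPMGroup.tautological`).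
([IUTchI] Ex 6.2 (i) p.159) [claim: Mochizuki2012, status: disputed] -/
theorem FlPMGroup.ofAddTorsor_zero_eq_tautological (l : ℕ) :
    FlPMGroup.ofAddTorsor l (0 : ZMod l) = FlPMGroup.tautological l := by
  apply FlPMGroup.eq_of_charts_eq
  ext e
  constructor
  · rintro ⟨ε, rfl⟩
    exact ⟨ε, Equiv.ext fun z => by simp⟩
  · rintro ⟨ε, rfl⟩
    exact ⟨ε, Equiv.ext fun z => by simp⟩

/-- **KIT-RULE / consistency**: `𝔽_l` acting on itself by translation yields EXACTLY the tautological
`𝔽_l^±`-torsor structure ([IUTchI] Ex 6.3 (i) p.160 "think of `𝔽_l` as an `𝔽_l^±`-torsor [relative to the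
tautological `𝔽_l^±`-torsor structure]", `FlPMTorsor.tautological`): the sign-affine bijections of `𝔽_l` are the
elements of `𝔽_l^{⋊±}`. ([IUTchI] Ex 6.3 (i) p.160) [claim: Mochizuki2012, status: disputed] -/
theorem FlPMTorsor.ofAddTorsor_zmod_eq_tautological (l : ℕ) :
    FlPMTorsor.ofAddTorsor l (ZMod l) = FlPMTorsor.tautological l := by
  apply FlPMTorsor.eq_of_charts_eq
  ext e
  constructor
  · rintro ⟨ε, he⟩
    refine ⟨FlPM.mk (e 0) ε, Equiv.ext fun z => ?_⟩
    have hz := he z 0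
    rw [vadd_eq_add, add_zero] at hz
    rw [FlPM.toPerm_apply, FlPM.mk_smul, hz]
  · rintro ⟨g, rfl⟩
    exact ⟨g.right, fun q z => by
      rw [FlPM.toPerm_apply, FlPM.toPerm_apply, vadd_eq_add, FlPM.smul_def, FlPM.smul_def, smul_add, add_assoc]⟩

end Literature.IUT.HodgeTheaters
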